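import Summits.AtomisticToContinuum.BoseEinsteinCondensation.Theses.BECThomsonPrinciple

/-!
# Sketch — crux `DensityResponse` (stmt-AtomisticToContinuum-9481), idea `force-balance-constitutive`

crux-ideate round 1, ideator 3 (planner-cruxidea-stmt-AtomisticToContinuum-9481-3-g2-0).
Vocabulary of the line (the waves generated by the density-wave displacement field
`u_k(x) = k sin(k·x)/|k|²`), the FIRST LEMMA `stationary_reduction` (signature only, `sorry`),
the open core `ConstitutiveInequality` (a `Prop`), and the two closing algebra steps (proved).
-/

namespace Summit.AtomisticToContinuum.BoseEinsteinCondensation.Cruxes.DensityResponse.ForceBalance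

open MeasureTheory WithLp
open scoped ENNReal ComplexConjugate
open Literature.MathematicalPhysics.QuantumManyBody.BoseGas

noncomputable section

variable {N : ℕ} {L : ℝ}

/-- The wave vector `k = (2π/L)·n ∈ ℝ³`. -/
def kvec (L : ℝ) (n : Fin 3 → ℤ) : Space := toLp 2 fun j => 2 * Real.pi / L * (n j : ℝ)

/-- `|k|² = (2π/L)² ∑ⱼ nⱼ²` (Euclidean; the crux's denominator uses the sup norm of `n`, equivalent
up to a factor `3`). -/
def ksq (L : ℝ) (n : Fin 3 → ℤ) : ℝ := (2 * Real.pi / L) ^ 2 * ∑ j, (n j : ℝ) ^ 2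

/-- The phase `θᵢ(X) = k·xᵢ`. -/
def phase (L : ℝ) (n : Fin 3 → ℤ) (X : Config N) (i : Fin N) : ℝ :=
  2 * Real.pi / L * ∑ j, (n j : ℝ) * X i j

/-- `k·∇ᵢ g (X)` — derivative of `g` at `X` along `k` in the coordinates of particle `i`. -/
def kDeriv (L : ℝ) (n : Fin 3 → ℤ) (g : Config N → ℂ) (X : Config N) (i : Fin N) : ℂ :=
  fderiv ℝ g X (Pi.single i (kvec L n))

/-- The (signed) density wave `m(Φ) = ∫ (∑ᵢ 2cos θᵢ)|Φ|²` — the crux's source without `|·|`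
(the absolute value is decoration: disprover's `densityResponseNoAbs_iff`). -/
def sourceMean (n : Fin 3 → ℤ) (Φ : PeriodicTrialState N L) : ℝ :=
  ∫ X in cellN N L, (∑ i, 2 * Real.cos (phase L n X i)) * ‖Φ.ψ X‖ ^ 2

/-- `N_eff(Φ) = 2∫ (∑ᵢ sin² θᵢ)|Φ|² ∈ [0, 2N]` — minus the first variation of `m` along the flow of
`u_k`: `d/dτ m(Φ^τ)|₀ = -N_eff(Φ)`. -/
def effNumber (n : Fin 3 → ℤ) (Φ : PeriodicTrialState N L) : ℝ :=
  ∫ X in cellN N L, (∑ i, 2 * Real.sin (phase L n X i) ^ 2) * ‖Φ.ψ X‖ ^ 2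

/-- KINETIC STRESS WAVE `K_k(Φ) = 2∫ ∑ᵢ cos θᵢ |k̂·∇ᵢΦ|²` (modulated longitudinal kinetic energy). -/
def kineticStressWave (n : Fin 3 → ℤ) (Φ : PeriodicTrialState N L) : ℝ :=
  ∫ X in cellN N L, ∑ i, 2 * Real.cos (phase L n X i) * (‖kDeriv L n Φ.ψ X i‖ ^ 2 / ksq L n)

/-- VIRIAL WAVE `I_k(Φ) = ∫ W(X) · ∑ᵢ [cos θᵢ |Φ|² + (sin θᵢ/|k|²)·k·∇ᵢ|Φ|²] dX`
(`W = ∑_{i<j} v^per(xᵢ-xⱼ)`), i.e. `∫ W div_X(|Φ|² U)` for `U = (u_k(x₁),…,u_k(x_N))`: minus the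
first variation of the interaction along the flow of `u_k`; for `v ∈ C¹` it equals
`-∫ |Φ|² ∑_{i<j} (u_k(xᵢ)-u_k(xⱼ))·(∇v)(xᵢ-xⱼ)` (the modulated virial). The derivative sits on
`|Φ|²`, so only measurability of `v` is used. -/
def virialWave (v : ℝ → ℝ≥0∞) (n : Fin 3 → ℤ) (Φ : PeriodicTrialState N L) : ℝ :=
  ∫ X in cellN N L, (periodicInteraction v L X).toReal *
    ∑ i, (Real.cos (phase L n X i) * ‖Φ.ψ X‖ ^ 2
      + Real.sin (phase L n X i) / ksq L n * (2 * ((starRingEnd ℂ) (Φ.ψ X) * kDeriv L n Φ.ψ X i).re))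

/-- STRESS WAVE `P_k(Φ) = K_k + (|k|²/4)·m + I_k` — minus the first variation of `periodicEnergy`
along the flow of `u_k` (`= ⟨Φ,[H,D_u]Φ⟩`, `D_u = ∑ᵢ (u(xᵢ)·∇ᵢ + ½ div u(xᵢ))`); the `(|k|²/4)m`
term is the kinetic energy of the half-density Jacobian factor. -/
def stressWave (v : ℝ → ℝ≥0∞) (n : Fin 3 → ℤ) (Φ : PeriodicTrialState N L) : ℝ :=
  kineticStressWave n Φ + ksq L n / 4 * sourceMean n Φ + virialWave v n Φ

/-- **FIRST LEMMA (transport-stationarity reduction).** For bounded `v`, `n ≠ 0`, any drive `s` and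
any trial state `Φ`, transporting `Φ` along the flow of `u_k` for the optimal time (the driven
functional `E - s·m` is `C¹` in the flow time and coercive) yields a trial state with no larger driven
energy which is TRANSPORT-STATIONARY: `P_k(Φ') = s·N_eff(Φ')` — the `k`-component of the local
momentum balance `∇·Π = -n∇U` (differential virial theorem) in variational form. Size M. -/
theorem stationary_reduction (v : ℝ → ℝ≥0∞) (hv : IsRepulsiveFiniteRange v)
    (hb : ∃ B : ℝ, ∀ r, v r ≤ ENNReal.ofReal B) (hL : 0 < L) (n : Fin 3 → ℤ) (hn : n ≠ 0) (s : ℝ)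
    (Φ : PeriodicTrialState N L) :
    ∃ Φ' : PeriodicTrialState N L,
      (periodicEnergy v Φ').toReal - s * sourceMean n Φ'
          ≤ (periodicEnergy v Φ).toReal - s * sourceMean n Φ ∧
        stressWave v n Φ' = s * effNumber n Φ' := by
  sorry

/-- **The open core (C⁺, equivalent to the crux for bounded `v`): linear response of
transport-stationary sub-ground driven states**, written as the CONSTITUTIVE (local
equation-of-state) inequality "stress–virial wave ≥ κ·ρa·density wave, up to a slack `∝ sN`":
for bounded admissible `v` and window parameter `M` there are `ρ₀, κ, C₁ > 0, N₀` such that every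
transport-stationary state at drive level `s ≥ 0` whose driven energy is below `E₀` and whose density
wave is nonnegative satisfies `κ·(ρa)·m(Φ) ≤ K_k(Φ) + I_k(Φ) + C₁·s·N`
(Bogoliubov value: `K_k + I_k = 4πρa·m` exactly, at every `k`). -/
def ConstitutiveInequality : Prop :=
  ∀ v : ℝ → ℝ≥0∞, IsRepulsiveFiniteRange v → (∃ B : ℝ, ∀ r, v r ≤ ENNReal.ofReal B) →
    ∀ M : ℝ, 0 < M → ∃ ρ₀ κ C₁ : ℝ, 0 < ρ₀ ∧ 0 < κ ∧ 0 < C₁ ∧ ∃ N₀ : ℕ, ∀ N : ℕ, N₀ ≤ N →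
      ∀ L : ℝ, 0 < L → (N : ℝ) ≤ ρ₀ * L ^ 3 → ∀ n : Fin 3 → ℤ, n ≠ 0 →
        2 * Real.pi * ‖(fun j => (n j : ℝ))‖ / L ≤ M * Real.sqrt (N / L ^ 3) → ∀ s : ℝ, 0 ≤ s →
          ∀ Φ : PeriodicTrialState N L,
            stressWave v n Φ = s * effNumber n Φ →
            (periodicEnergy v Φ).toReal - s * sourceMean n Φ
                ≤ (periodicGroundStateEnergy v N L).toReal →
            0 ≤ sourceMean n Φ →
              κ * (N / L ^ 3 * (scatteringLength v).toReal) * sourceMean n Φ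
                ≤ kineticStressWave n Φ + virialWave v n Φ + C₁ * s * N

/-- Closing algebra, step 1 (proved): stationarity `K + (q/4)m + I = s·N_eff`, `N_eff ≤ 2N`, and the
constitutive inequality `κ'·m ≤ K + I + C₁ s N` give the LINEAR-RESPONSE bound
`m ≤ 4(2 + C₁) s N/(q + 4κ')`. -/
theorem linear_response_of_constitutive {K I m Neff s q κ' C₁ Nr : ℝ} (hq : 0 < q) (hκ : 0 ≤ κ')
    (hs : 0 ≤ s) (hstat : K + q / 4 * m + I = s * Neff)
    (hNeff : Neff ≤ 2 * Nr) (hcons : κ' * m ≤ K + I + C₁ * s * Nr) :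
    m ≤ 4 * (2 + C₁) * s * Nr / (q + 4 * κ') := by
  rw [le_div_iff₀ (by positivity)]
  nlinarith [mul_le_mul_of_nonneg_left hNeff hs]

/-- Closing algebra, step 2 (proved): reduction + `E₀ ≤ E(Φ')` + linear response give the CHORD
`E₀ - B s² ≤ E(Φ) - s·m(Φ)` (the crux's inner inequality with `B = C N/(k²+ρa)`). -/
theorem chord_of_linear_response {E E' E₀ m m' s B : ℝ} (hred : E' - s * m' ≤ E - s * m)
    (hE' : E₀ ≤ E') (hm' : m' ≤ B * s) (hs : 0 ≤ s) : E₀ - B * s ^ 2 ≤ E - s * m := by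
  nlinarith [mul_le_mul_of_nonneg_left hm' hs]

/-- The intended conclusion of the line (crux-plan target; composition of the lemmas above with the
half-wavelength translation for the sign of `m`, `N_eff ≤ 2N`, `q ≍ k∞²`, and the large-`s`
triviality). Stated here only to record that the reduction is typed against the crux BY NAME. -/
theorem densityResponse_of_constitutive_bounded :
    ConstitutiveInequality →
      ∀ v : ℝ → ℝ≥0∞, IsRepulsiveFiniteRange v → (∃ B : ℝ, ∀ r, v r ≤ ENNReal.ofReal B) →
        ∀ M : ℝ, 0 < M → ∃ ρ₀ C : ℝ, 0 < ρ₀ ∧ 0 < C ∧ ∃ N₀ : ℕ, ∀ N : ℕ, N₀ ≤ N → ∀ L : ℝ, 0 < L →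
          (N : ℝ) ≤ ρ₀ * L ^ 3 → ∀ n : Fin 3 → ℤ, n ≠ 0 →
            2 * Real.pi * ‖(fun j => (n j : ℝ))‖ / L ≤ M * Real.sqrt (N / L ^ 3) → ∀ s : ℝ, 0 ≤ s →
              ∀ Φ : PeriodicTrialState N L,
                periodicGroundStateEnergy v N L + ENNReal.ofReal (s * |∫ X in cellN N L,
                    (∑ i, 2 * Real.cos (2 * Real.pi / L * ∑ j, (n j : ℝ) * X i j)) * ‖Φ.ψ X‖ ^ 2|)
                  ≤ periodicEnergy v Φ + ENNReal.ofReal (C * s ^ 2 * N /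
                      ((2 * Real.pi * ‖(fun j => (n j : ℝ))‖ / L) ^ 2
                        + N / L ^ 3 * (scatteringLength v).toReal)) := by
  sorry

/-- Sanity: the conclusion above is literally the crux's body restricted to bounded `v`. -/
example (h : Theses.BECThomsonPrinciple.DensityResponse) (v : ℝ → ℝ≥0∞)
    (hv : IsRepulsiveFiniteRange v) (M : ℝ) (hM : 0 < M) :
    ∃ ρ₀ C : ℝ, 0 < ρ₀ ∧ 0 < C ∧ ∃ N₀ : ℕ, ∀ N : ℕ, N₀ ≤ N → ∀ L : ℝ, 0 < L →
      (N : ℝ) ≤ ρ₀ * L ^ 3 → ∀ n : Fin 3 → ℤ, n ≠ 0 →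
        2 * Real.pi * ‖(fun j => (n j : ℝ))‖ / L ≤ M * Real.sqrt (N / L ^ 3) → ∀ s : ℝ, 0 ≤ s →
          ∀ Φ : PeriodicTrialState N L,
            periodicGroundStateEnergy v N L + ENNReal.ofReal (s * |∫ X in cellN N L,
                (∑ i, 2 * Real.cos (2 * Real.pi / L * ∑ j, (n j : ℝ) * X i j)) * ‖Φ.ψ X‖ ^ 2|)
              ≤ periodicEnergy v Φ + ENNReal.ofReal (C * s ^ 2 * N /
                  ((2 * Real.pi * ‖(fun j => (n j : ℝ))‖ / L) ^ 2
                    + N / L ^ 3 * (scatteringLength v).toReal)) :=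
  h v hv M hM

end

end Summit.AtomisticToContinuum.BoseEinsteinCondensation.Cruxes.DensityResponse.ForceBalance
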